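import Summits.AnomalousDissipation.AnomalousDissipation.Statement
import Literature.Analysis.FluidPDE.DoeringFoiasProofs
import Literature.Analysis.FluidPDE.DoeringFoiasPowerProofs
import Literature.Analysis.FluidPDE.LerayHopfUniformEnergyMomentum
import Literature.Analysis.FluidPDE.IntegratedChainRule
import HarnessLib

/-!
# Exact energy balance of a test mode and the finite-family flux budget (solo-informed)

Fix a global Leray–Hopf solution `u` of `NS_ν + f` on `T^d` (`ν > 0`, `f` steady smooth) and a
smooth divergence-free test field `Φ`, with mode amplitude `a(t) = (u(t), Φ)`.  Testing the weak
formulation with `Φ` (`Torus.IsLerayHopfOn.integral_inner_eq_add_setIntegral`) gives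
`a(t) = a(0) + ∫₀ᵗ G`, `G = (u ⊗ u : ∇Φ) + ν (u, ΔΦ) + (f, Φ)`, and the chain rule for absolutely
continuous functions (`Literature.Analysis.FluidPDE.comp_mul_sub_comp_mul_eq_integral`) yields the
EXACT energy balance of the mode, `lerayHopf_testMode_sq_identity`:
`a(T)² − a(0)² = 2 ∫₀ᵀ a G` (Temam 1984, Ch. III (1.22)–(1.25)).

The file also supplies the three analytic inputs of the finite-family flux budget proved in
`SoloInformedSpectralFluxFloor`: the real-variable bookkeeping (`fluxBudget_core`,
`timeMean_le_of_integral_le`, `limsup_le_limsup_add_map_limsup`), integrability of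
`s ↦ (u(s), a) g(s)` (`lerayHopf_integrableOn_inner_mul`) and the Cauchy–Schwarz–Jensen bound
`|⟨(u, a)⟩_T| ≤ ‖a‖₂ ⟨‖u‖²⟩_T^{1/2}` for a continuous test field and a general force
(`lerayHopf_abs_timeMean_inner_le_of_continuous`; Cheskidov–Doering–Petrov 2007, eq. (17)).
References: R. Temam, *Navier–Stokes Equations* (1984) Ch. III [Temam1984]; A. Cheskidov,
C. R. Doering, N. P. Petrov, J. Math. Phys. 48 (2007) [CheskidovDoeringPetrov2006]; U. Frisch,
*Turbulence* (1995) §6.2 [Frisch1995].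
-/

noncomputable section

open MeasureTheory Filter Topology Set
open scoped ENNReal NNReal InnerProductSpace RealInnerProductSpace

namespace Summit.AnomalousDissipation.AnomalousDissipation.Theorems

open Literature.Analysis.FunctionSpaces Literature.Analysis.FluidPDE

/-! ### Real-variable bookkeeping -/

/-- If eventually `x_T ≤ p_T + h(m_T) + c T⁻¹` with `x ≥ 0`, `|p| ≤ B`, `0 ≤ m ≤ B` and `h`
monotone continuous, then `limsup x ≤ limsup p + h(limsup m)`. [folklore] -/
theorem limsup_le_limsup_add_map_limsup {x p m : ℝ → ℝ} {h : ℝ → ℝ} (hh : Monotone h)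
    (hhc : Continuous h) {c B : ℝ} (hx0 : ∀ᶠ T in atTop, 0 ≤ x T)
    (hp : ∀ᶠ T in atTop, |p T| ≤ B) (hm0 : ∀ᶠ T in atTop, 0 ≤ m T)
    (hmB : ∀ᶠ T in atTop, m T ≤ B) (hle : ∀ᶠ T in atTop, x T ≤ p T + h (m T) + c * T⁻¹) :
    limsup x atTop ≤ limsup p atTop + h (limsup m atTop) := by
  have hc : Tendsto (fun T : ℝ => c * T⁻¹) atTop (𝓝 0) := by
    simpa using tendsto_inv_atTop_zero.const_mul c
  have hpa : IsBoundedUnder (· ≤ ·) atTop p :=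
    isBoundedUnder_of_eventually_le (hp.mono fun T hT => (abs_le.1 hT).2)
  have hpb : IsBoundedUnder (· ≥ ·) atTop p :=
    isBoundedUnder_of_eventually_ge (hp.mono fun T hT => (abs_le.1 hT).1)
  have hra : IsBoundedUnder (· ≤ ·) atTop (h ∘ m) :=
    isBoundedUnder_of_eventually_le (hmB.mono fun T hT => hh hT)
  have hrb : IsBoundedUnder (· ≥ ·) atTop (h ∘ m) :=
    isBoundedUnder_of_eventually_ge (hm0.mono fun T hT => hh hT)
  have hma : IsBoundedUnder (· ≤ ·) atTop m := isBoundedUnder_of_eventually_le hmB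
  have hmc : IsCoboundedUnder (· ≤ ·) atTop m := isCoboundedUnder_le_of_eventually_le atTop hm0
  have hqa : IsBoundedUnder (· ≤ ·) atTop (fun T : ℝ => c * T⁻¹) := hc.isBoundedUnder_le
  have hqb : IsBoundedUnder (· ≥ ·) atTop (fun T : ℝ => c * T⁻¹) := hc.isBoundedUnder_ge
  have h1 : limsup x atTop ≤ limsup (p + ((h ∘ m) + fun T : ℝ => c * T⁻¹)) atTop := by
    refine limsup_le_limsup (hle.mono fun T hT => ?_)
      (isCoboundedUnder_le_of_eventually_le atTop hx0)
      (isBoundedUnder_le_add hpa (isBoundedUnder_le_add hra hqa))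
    simpa only [Pi.add_apply, Function.comp, add_assoc] using hT
  have h2 : limsup (p + ((h ∘ m) + fun T : ℝ => c * T⁻¹)) atTop ≤
      limsup p atTop + limsup ((h ∘ m) + fun T : ℝ => c * T⁻¹) atTop :=
    limsup_add_le hpb hpa (isBoundedUnder_ge_add hrb hqb).isCoboundedUnder_le
      (isBoundedUnder_le_add hra hqa)
  have h3 : limsup ((h ∘ m) + fun T : ℝ => c * T⁻¹) atTop ≤
      limsup (h ∘ m) atTop + limsup (fun T : ℝ => c * T⁻¹) atTop :=
    limsup_add_le hrb hra hqb.isCoboundedUnder_le hqa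
  have h4 : limsup (h ∘ m) atTop = h (limsup m atTop) :=
    (hh.map_limsup_of_continuousAt m hhc.continuousAt hma hmc).symm
  rw [hc.limsup_eq, add_zero, h4] at h3
  linarith

/-- `∫₀ᵀ D ≤ ∫₀ᵀ P + Λ ∫₀ᵀ e + T X + C` divided by `T > 0`, in terms of running means.
[folklore] -/
theorem timeMean_le_of_integral_le {D P e : ℝ → ℝ} {T Λ X C : ℝ} (hT : 0 < T)
    (h : (∫ s in (0:ℝ)..T, D s) ≤
      (∫ s in (0:ℝ)..T, P s) + Λ * (∫ s in (0:ℝ)..T, e s) + T * X + C) :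
    timeMean D T ≤ timeMean P T + Λ * timeMean e T + X + C * T⁻¹ := by
  unfold timeMean
  have hTT : T⁻¹ * T = 1 := inv_mul_cancel₀ hT.ne'
  calc T⁻¹ * ∫ s in (0:ℝ)..T, D s
      ≤ T⁻¹ * ((∫ s in (0:ℝ)..T, P s) + Λ * (∫ s in (0:ℝ)..T, e s) + T * X + C) :=
        mul_le_mul_of_nonneg_left h (inv_pos.2 hT).le
    _ = T⁻¹ * (∫ s in (0:ℝ)..T, P s) + Λ * (T⁻¹ * ∫ s in (0:ℝ)..T, e s) + T⁻¹ * T * X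
        + C * T⁻¹ := by ring
    _ = _ := by rw [hTT, one_mul]

/-- **Bookkeeping core of the finite-family flux budget on `[0, T]`**: the mode identities
`aᵢ(T)² − bᵢ² = 2∫₀ᵀ aᵢ Gᵢ` with `Gᵢ = Sᵢ + ν Lᵢ + cᵢ`, the power split `p = ∑ᵢ cᵢ aᵢ + r`, the
bounds `−aᵢLᵢ ≤ wᵢ e`, `aᵢ(T)² ≤ R qᵢ`, `∫₀ᵀ r ≤ T J` and the energy inequality
`∫₀ᵀ D ≤ E₀ + ∫₀ᵀ p` give `∫₀ᵀ D ≤ ∫₀ᵀ (−∑ᵢ aᵢSᵢ) + ν (∑ᵢ wᵢ) ∫₀ᵀ e + T J + E₀ + ½ R ∑ᵢ qᵢ`.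
[folklore] -/
theorem fluxBudget_core {ι : Type*} [Fintype ι] {T ν E₀ R J : ℝ} (hT : 0 < T) (hν : 0 ≤ ν)
    {D p r e : ℝ → ℝ} {a S L G : ι → ℝ → ℝ} {b c q w : ι → ℝ}
    (hIaS : ∀ i, IntervalIntegrable (fun s => a i s * S i s) volume 0 T)
    (hIaL : ∀ i, IntervalIntegrable (fun s => a i s * L i s) volume 0 T)
    (hIa : ∀ i, IntervalIntegrable (a i) volume 0 T) (hIe : IntervalIntegrable e volume 0 T)
    (hIr : IntervalIntegrable r volume 0 T) (hIp : IntervalIntegrable p volume 0 T)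
    (hmode : ∀ i, (a i T) ^ 2 - (b i) ^ 2 = 2 * ∫ s in (0:ℝ)..T, a i s * G i s)
    (hsplit : ∀ i, ∀ s ∈ Ioc 0 T, G i s = S i s + ν * L i s + c i)
    (hpow : ∀ s ∈ Ioc 0 T, p s = (∑ i, c i * a i s) + r s)
    (haL : ∀ i, ∀ s ∈ Icc 0 T, -(a i s * L i s) ≤ w i * e s)
    (hbd : ∀ i, (a i T) ^ 2 ≤ R * q i)
    (hEI : (∫ s in (0:ℝ)..T, D s) ≤ E₀ + ∫ s in (0:ℝ)..T, p s)
    (hJ : (∫ s in (0:ℝ)..T, r s) ≤ T * J) :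
    (∫ s in (0:ℝ)..T, D s) ≤ (∫ s in (0:ℝ)..T, -∑ i, a i s * S i s)
      + ν * (∑ i, w i) * (∫ s in (0:ℝ)..T, e s) + T * J + (E₀ + 2⁻¹ * R * ∑ i, q i) := by
  have hIoc : Set.uIoc (0:ℝ) T = Ioc 0 T := uIoc_of_le hT.le
  have hIaG : ∀ i, ∫ s in (0:ℝ)..T, a i s * G i s = (∫ s in (0:ℝ)..T, a i s * S i s)
      + ν * (∫ s in (0:ℝ)..T, a i s * L i s) + c i * ∫ s in (0:ℝ)..T, a i s := by
    intro i
    rw [← intervalIntegral.integral_const_mul, ← intervalIntegral.integral_const_mul,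
      ← intervalIntegral.integral_add (hIaS i) ((hIaL i).const_mul ν),
      ← intervalIntegral.integral_add ((hIaS i).add ((hIaL i).const_mul ν))
        ((hIa i).const_mul _)]
    refine intervalIntegral.integral_congr_ae (ae_of_all _ fun s hs => ?_)
    rw [hIoc] at hs
    rw [hsplit i s hs]
    ring
  have hci : ∀ i, c i * ∫ s in (0:ℝ)..T, a i s = ((a i T) ^ 2 - (b i) ^ 2) / 2
      - (∫ s in (0:ℝ)..T, a i s * S i s) - ν * ∫ s in (0:ℝ)..T, a i s * L i s := by
    intro i
    have h2 := hmode i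
    have h3 := hIaG i
    linarith
  have hsum : ∑ i, c i * ∫ s in (0:ℝ)..T, a i s =
      (∑ i, ((a i T) ^ 2 - (b i) ^ 2) / 2) - (∑ i, ∫ s in (0:ℝ)..T, a i s * S i s)
        - ν * ∑ i, ∫ s in (0:ℝ)..T, a i s * L i s := by
    rw [Finset.sum_congr rfl fun i _ => hci i, Finset.sum_sub_distrib, Finset.sum_sub_distrib,
      Finset.mul_sum]
  have hPi : ∫ s in (0:ℝ)..T, -∑ i, a i s * S i s = -∑ i, ∫ s in (0:ℝ)..T, a i s * S i s := by
    rw [intervalIntegral.integral_neg, intervalIntegral.integral_finsetSum fun i _ => hIaS i]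
  have hIca : IntervalIntegrable (fun s => ∑ i, c i * a i s) volume 0 T := by
    refine (hIp.sub hIr).congr fun s hs => ?_
    rw [hIoc] at hs
    show p s - r s = ∑ i, c i * a i s
    rw [hpow s hs]
    ring
  have hP : ∫ s in (0:ℝ)..T, p s =
      (∑ i, c i * ∫ s in (0:ℝ)..T, a i s) + ∫ s in (0:ℝ)..T, r s := by
    have h1 : ∫ s in (0:ℝ)..T, p s = ∫ s in (0:ℝ)..T, ((∑ i, c i * a i s) + r s) :=
      intervalIntegral.integral_congr_ae (ae_of_all _ fun s hs => by
        rw [hIoc] at hs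
        exact hpow s hs)
    rw [h1, intervalIntegral.integral_add hIca hIr,
      intervalIntegral.integral_finsetSum fun i _ => (hIa i).const_mul (c i)]
    simp only [intervalIntegral.integral_const_mul]
  have hvisc : -(ν * ∑ i, ∫ s in (0:ℝ)..T, a i s * L i s) ≤
      ν * (∑ i, w i) * ∫ s in (0:ℝ)..T, e s := by
    have h1 : ∀ i, -(∫ s in (0:ℝ)..T, a i s * L i s) ≤ w i * ∫ s in (0:ℝ)..T, e s := by
      intro i
      rw [← intervalIntegral.integral_neg, ← intervalIntegral.integral_const_mul]
      exact intervalIntegral.integral_mono_on hT.le (hIaL i).neg (hIe.const_mul _)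
        fun s hs => haL i s hs
    have h2 : -(∑ i, ∫ s in (0:ℝ)..T, a i s * L i s) ≤ (∑ i, w i) * ∫ s in (0:ℝ)..T, e s := by
      rw [← Finset.sum_neg_distrib, Finset.sum_mul]
      exact Finset.sum_le_sum fun i _ => h1 i
    have h3 := mul_le_mul_of_nonneg_left h2 hν
    linarith
  have hbdsum : ∑ i, ((a i T) ^ 2 - (b i) ^ 2) / 2 ≤ 2⁻¹ * R * ∑ i, q i := by
    rw [mul_assoc, Finset.mul_sum, Finset.mul_sum]
    refine Finset.sum_le_sum fun i _ => ?_
    have := hbd i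
    nlinarith [sq_nonneg (b i)]
  linarith [hEI, hP, hsum, hbdsum, hvisc, hJ, hPi]

variable {d : Type*} [Fintype d] [DecidableEq d]

section OneSolution

variable {ν : ℝ} {f u₀ Φ : UnitAddTorus d → EuclideanSpace ℝ d}
  {u : ℝ → UnitAddTorus d → EuclideanSpace ℝ d}

/-- `s ↦ (u(s), a) g(s)` is integrable on `(0, T)` for a continuous test field `a` and an
integrable `g` (`(u, a)` is measurable and bounded by `‖a‖_∞ sup ‖u‖_{L¹}`). [folklore] -/
theorem lerayHopf_integrableOn_inner_mul {F : ℝ → UnitAddTorus d → EuclideanSpace ℝ d}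
    (hu : Torus.IsGlobalLerayHopf ν F u₀ u) {a : UnitAddTorus d → EuclideanSpace ℝ d}
    (ha : Continuous a) {T : ℝ} (hT : 0 < T) {g : ℝ → ℝ} (hg : IntegrableOn g (Ioo 0 T)) :
    IntegrableOn (fun s => (∫ x, ⟪u s x, a x⟫) * g s) (Ioo 0 T) := by
  obtain ⟨K, hK0, hK⟩ := Torus.exists_nonneg_forall_norm_le_of_continuous ha
  obtain ⟨C, hC0, hC⟩ := (hu T hT).exists_integral_norm_sq_le
  refine Integrable.bdd_mul (c := K * (2⁻¹ * (1 + C))) hg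
    ((hu T hT).aestronglyMeasurable_integral_inner ha) ?_
  filter_upwards [hC, ae_restrict_mem measurableSet_Ioo] with s hs hsI
  have hmem : MemLp (u s) 2 volume := hu.memLp_two hsI.1.le
  rw [Real.norm_eq_abs]
  calc |∫ x, ⟪u s x, a x⟫| ≤ K * ∫ x, ‖u s x‖ :=
        Torus.abs_integral_inner_le_of_norm_le (hmem.integrable one_le_two) hK
    _ ≤ K * (2⁻¹ * (1 + ∫ x, ‖u s x‖ ^ 2)) :=
        mul_le_mul_of_nonneg_left (Torus.integral_norm_le_of_memLp_two hmem) hK0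
    _ ≤ K * (2⁻¹ * (1 + C)) := by gcongr

/-- **Cauchy–Schwarz in space and Jensen in time** for a continuous test field `a`:
`|T⁻¹∫₀ᵀ (u, a)| ≤ ‖a‖₂ (T⁻¹∫₀ᵀ ‖u‖₂²)^{1/2}` (Cheskidov–Doering–Petrov 2007, Jensen step
(J1) before eq. (17)). [cite: CheskidovDoeringPetrov2006, eq. (17)] -/
theorem lerayHopf_abs_timeMean_inner_le_of_continuous
    {F : ℝ → UnitAddTorus d → EuclideanSpace ℝ d} (hu : Torus.IsGlobalLerayHopf ν F u₀ u)
    {a : UnitAddTorus d → EuclideanSpace ℝ d} (ha : Continuous a) {T : ℝ} (hT : 0 < T) :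
    |timeMean (fun t => ∫ x, ⟪u t x, a x⟫) T| ≤
      Real.sqrt (∫ x, ‖a x‖ ^ 2) * Real.sqrt (timeMean (fun t => ∫ x, ‖u t x‖ ^ 2) T) := by
  set E : ℝ → ℝ := fun τ => ∫ x, ‖u τ x‖ ^ 2 with hEdef
  set P : ℝ → ℝ := fun τ => ∫ x, ⟪u τ x, a x⟫ with hPdef
  set A : ℝ := Real.sqrt (∫ x, ‖a x‖ ^ 2) with hA
  have haL2 : MemLp a 2 volume :=
    ha.memLp_of_hasCompactSupport (HasCompactSupport.of_compactSpace a)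
  have hA0 : 0 ≤ A := Real.sqrt_nonneg _
  have hE0 : ∀ τ, 0 ≤ E τ := fun τ => integral_nonneg fun _ => sq_nonneg _
  have hEint : IntervalIntegrable E volume 0 T :=
    (intervalIntegrable_iff_integrableOn_Ioc_of_le hT.le).2 (hu.integrableOn_integral_norm_sq hT)
  have hPint : IntervalIntegrable P volume 0 T := by
    rw [intervalIntegrable_iff_integrableOn_Ioc_of_le hT.le]
    exact (integrableOn_Ioc_iff_integrableOn_Ioo).mpr ((hu T hT).integrableOn_integral_inner ha)
  refine le_mul_sqrt_of_forall_pos hA0 (timeMean_nonneg hE0 hT.le) fun α hα => ?_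
  have hmono : ∫ τ in (0 : ℝ)..T, |P τ| ≤ ∫ τ in (0 : ℝ)..T, A * (E τ / (2 * α) + α / 2) := by
    refine intervalIntegral.integral_mono_on hT.le hPint.abs
      (((hEint.div_const _).add _root_.intervalIntegrable_const).const_mul A) fun τ hτ => ?_
    have hcs : |P τ| ≤ A * Real.sqrt (E τ) := by
      rw [mul_comm]
      exact abs_integral_inner_le_sqrt_mul_sqrt (hu.memLp_two hτ.1) haL2
    refine hcs.trans (mul_le_mul_of_nonneg_left ?_ hA0)
    have hsq : Real.sqrt (E τ) ^ 2 = E τ := Real.sq_sqrt (hE0 τ)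
    have hid : E τ / (2 * α) + α / 2 = (Real.sqrt (E τ) ^ 2 + α ^ 2) / (2 * α) := by
      rw [hsq]
      field_simp
    rw [hid, le_div_iff₀ (by positivity)]
    nlinarith [sq_nonneg (Real.sqrt (E τ) - α)]
  rw [intervalIntegral.integral_const_mul,
    intervalIntegral.integral_add (hEint.div_const _) _root_.intervalIntegrable_const,
    intervalIntegral.integral_div, intervalIntegral.integral_const, sub_zero, smul_eq_mul] at hmono
  have habs : |∫ τ in (0 : ℝ)..T, P τ| ≤ ∫ τ in (0 : ℝ)..T, |P τ| :=
    intervalIntegral.abs_integral_le_integral_abs hT.le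
  unfold timeMean
  rw [abs_mul, abs_of_pos (inv_pos.2 hT)]
  calc T⁻¹ * |∫ τ in (0 : ℝ)..T, P τ|
      ≤ T⁻¹ * (A * ((∫ τ in (0 : ℝ)..T, E τ) / (2 * α) + T * (α / 2))) :=
        mul_le_mul_of_nonneg_left (habs.trans hmono) (inv_nonneg.2 hT.le)
    _ = A * (T⁻¹ * (∫ τ in (0 : ℝ)..T, E τ) / (2 * α) + α / 2) := by
        field_simp

/-- **Exact energy identity of one test mode.** For a steady smooth divergence-free `Φ` and
`T > 0`, with `a(s) = (u(s), Φ)`: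
`a(T)² − (u₀, Φ)² = 2 ∫₀ᵀ a(s) [(u ⊗ u : ∇Φ) + ν (u, ΔΦ) + (f, Φ)](s) ds`
(the weak formulation tested with `Φ`, Temam 1984 Ch. III (1.22)–(1.25), and the chain rule for
the absolutely continuous `a`). [cite: Temam1984, Ch. III (1.22)–(1.25)] -/
theorem lerayHopf_testMode_sq_identity (hf : Torus.IsSmooth f) (hΦ : Torus.IsSmooth Φ)
    (hΦdiv : Torus.IsDivFree Φ) (hu : Torus.IsGlobalLerayHopf ν (fun _ => f) u₀ u) {T : ℝ}
    (hT : 0 < T) :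
    (∫ x, ⟪u T x, Φ x⟫) ^ 2 - (∫ x, ⟪u₀ x, Φ x⟫) ^ 2 =
      2 * ∫ s in (0:ℝ)..T, (∫ x, ⟪u s x, Φ x⟫) * ∫ x, (⟪u s x, Torus.convect (u s) Φ x⟫
        + ν * ⟪u s x, Torus.laplacian Φ x⟫ + ⟪f x, Φ x⟫) := by
  classical
  set G : ℝ → ℝ := fun s => ∫ x, (⟪u s x, Torus.convect (u s) Φ x⟫
    + ν * ⟪u s x, Torus.laplacian Φ x⟫ + ⟪f x, Φ x⟫) with hG
  set g : ℝ → ℝ := fun s => if 0 < s then ∫ x, ⟪u s x, Φ x⟫ else ∫ x, ⟪u₀ x, Φ x⟫ with hg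
  have hGint : IntervalIntegrable G volume 0 T := by
    rw [intervalIntegrable_iff_integrableOn_Ioc_of_le hT.le]
    exact (integrableOn_Ioc_iff_integrableOn_Ioo).mpr ((hu T hT).integrableOn_flux
      (aestronglyMeasurable_stLift_steady hf.continuous _)
      (lintegral_Ioo_lintegral_enorm_sq_steady_lt_top (hf.memLp 2) T) hΦ)
  have hg0 : g 0 = ∫ x, ⟪u₀ x, Φ x⟫ := by simp [hg]
  have hgpos : ∀ s, 0 < s → g s = ∫ x, ⟪u s x, Φ x⟫ := fun s hs => by simp [hg, hs]
  have hrep : ∀ s ∈ Icc 0 T, g s = g 0 + ∫ r in (0:ℝ)..s, G r := by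
    intro s hs
    rcases hs.1.eq_or_lt with h | h
    · rw [← h, intervalIntegral.integral_same, add_zero]
    · rw [hgpos s h, hg0, intervalIntegral.integral_of_le h.le]
      exact (hu T hT).integral_inner_eq_add_setIntegral hT
        (aestronglyMeasurable_stLift_steady hf.continuous _)
        (lintegral_Ioo_lintegral_enorm_sq_steady_lt_top (hf.memLp 2) T) hΦ hΦdiv ⟨h, hs.2⟩
  have hderiv : ∀ v : ℝ, deriv (fun v : ℝ => v ^ 2) v = 2 * v := fun v => by simp
  have hcr := comp_mul_sub_comp_mul_eq_integral hT.le hGint hrep (H := fun v : ℝ => v ^ 2)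
    (contDiff_id.pow 2) (η := fun _ : ℝ => (1:ℝ)) contDiff_const
  simp only [hderiv, deriv_const, mul_one, mul_zero, add_zero] at hcr
  rw [hgpos T hT, hg0] at hcr
  rw [hcr, ← intervalIntegral.integral_const_mul]
  refine intervalIntegral.integral_congr_ae (ae_of_all _ fun s hs => ?_)
  rw [uIoc_of_le hT.le] at hs
  rw [hgpos s hs.1]
  ring


end OneSolution

end Summit.AnomalousDissipation.AnomalousDissipation.Theorems

end
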